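import Literature.AlgebraicGeometry.Resolution.AffineBlowupAlgebra
import Literature.AlgebraicGeometry.Resolution.CoefficientIdeals
import HarnessLib

/-!
# BGMW Lemma 3.5.3 on a blow-up chart for all `r ≤ μ` (ring level)

Topic: `Literature/AlgebraicGeometry/Resolution`. Bierstone–Grigoriev–Milman–Włodarczyk, *Effective
Hironaka resolution and its complexity (with appendix on applications in positive
characteristic)*, arXiv:1206.3090, §3.5, **Lemma 3.5.3** (Giraud, Villamayor): "Let `(𝓘, μ)` be a
marked ideal, `C ⊂ supp(𝓘, μ)` a smooth center, and `r ≤ μ`. Let `σ : X ← X'` be a blow-up at `C`.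
Then `σᶜ(𝒟ʳ(𝓘, μ)) ⊆ 𝒟ʳ(σᶜ(𝓘, μ))`."

`DerivativeIdealsChart.lean` proves the case `r = 1` on one chart ring `S` of the blow-up under
the abstract hypotheses (i) `I·S = (a)`, `a` a non-zero-divisor, (ii) every `a·δ`
(`δ ∈ Der_k(R)`) extends to `S` (`colon_map_derivIdeal_le_derivIdeal_colon`), and
`AffineBlowupAlgebra.lean` discharges (i)–(ii) for the affine blowup algebras `R[I/a]`
(`blowupAlgebra.colon_map_derivIdeal_le`). This file PROVES the lemma **for all `r ≤ μ`**, as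
printed, by induction on `r` — the induction runs on the flexible form
"`𝓙·S ⊆ a^ν 𝓙' ⇒ 𝒟(𝓙)·S ⊆ a^{ν-1} 𝒟(𝓙')`" (`map_derivIdeal_le_pow_mul_derivIdeal`, same computation
as for `r = 1`: for `f = a^ν g`, `a·(δf) = D(a^ν g) = a^ν (D g + ν δ(a) g)` and `a` cancels),
applied successively to `(𝒟ⁱ𝓙, μ - i, 𝒟ⁱ𝓙')`:

* `map_derivIdealIter_le_pow_mul_derivIdealIter` — `𝓙·S ⊆ a^μ 𝓙' ⇒ 𝒟ʳ(𝓙)·S ⊆ a^{μ-r} 𝒟ʳ(𝓙')`;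
* `colon_map_derivIdealIter_le_derivIdealIter_colon` — **Lemma 3.5.3 on a chart**:
  `(𝒟ʳ(J)·S : a^{μ-r}) ⊆ 𝒟ʳ((J·S : a^μ))` for `J ⊆ I^μ` (`𝓘 ⊆ 𝓘_C^μ`, Lemma 3.2.1) and `r ≤ μ`;
* `blowupAlgebra.colon_map_derivIdealIter_le` — the same on the affine blowup algebra `R[I/a]`,
  `a ∈ I`, with no further hypothesis; `colon_map_derivIdealIter_le`,
  `colon_map_derivIdealIter_le_blowupAlgebra` — the same two statements with the base ring `k`
  explicit (the argument convention of `DerivativeIdealsChart.lean`);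
* `IsOfMaxOrder.colon_map`, `IsOfMaxOrder.colon_map_blowupAlgebra` — **BGMW Lemma 3.6.2 on a
  chart** ("Let `(𝓘, μ)` be a marked ideal of maximal order and let `C ⊂ supp(𝓘, μ)` be a smooth
  center … Then `σᶜ(𝓘, μ)` is of maximal order": `𝒟^μ(σᶜ(𝓘, μ)) ⊇ σᶜ(𝒟^μ(𝓘), 0) = 𝒪`), for the
  ring-level `IsOfMaxOrder` of `CoefficientIdeals.lean`: if `𝒟^μ(J) = R` then
  `𝒟^μ((J·S : a^μ)) = S` — the case `r = μ` of the above.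

Characteristic-free. The sheaf-level assembly over a blow-up in the sense of `Blowups.lean` is
left to a later file.

## Sources

* [BGMW 2011] §3.5 Lemma 3.5.3; §3.2 Lemma 3.2.1; §3.6 Def. 3.6.1, Lemma 3.6.2
  (arXiv:1206.3090 numbering).
  [BierstoneGrigorievMilmanWlodarczyk2011]
-/

namespace Literature.AlgebraicGeometry.Resolution

open scoped nonZeroDivisors

universe u v w

section Chart

variable {k : Type u} [CommRing k] {R : Type v} {S : Type w} [CommRing R] [CommRing S]
  [Algebra k R] [Algebra k S] [Algebra R S] {a : R}

/-- **The computation of BGMW Lemma 3.5.3, flexible form**: with `a·1_S` a non-zero-divisor and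
every `a·δ` extending to `S`, if `𝓙·S ⊆ a^ν · 𝓙'` and `ν ≥ 1` then `𝒟(𝓙)·S ⊆ a^{ν-1} · 𝒟(𝓙')`
(for `f = a^ν g`: `a·(δf)·1 = D(a^ν g) = a^ν (D g + ν (δa) g)`, and `a` cancels).
[cite: BierstoneGrigorievMilmanWlodarczyk2011, Lemma 3.5.3] -/
theorem map_derivIdeal_le_pow_mul_derivIdeal (ha : algebraMap R S a ∈ S⁰)
    (hext : ∀ δ : Derivation k R R, ∃ D : Derivation k S S,
      ∀ r : R, D (algebraMap R S r) = algebraMap R S a * algebraMap R S (δ r))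
    {J : Ideal R} {J' : Ideal S} {ν : ℕ} (hν : 1 ≤ ν)
    (h : J.map (algebraMap R S) ≤ Ideal.span {algebraMap R S a ^ ν} * J') :
    (derivIdeal k J).map (algebraMap R S) ≤
      Ideal.span {algebraMap R S a ^ (ν - 1)} * derivIdeal k J' := by
  set a' := algebraMap R S a with ha'
  -- `a'^ν 𝓙' ⊆ a'^{ν-1} 𝒟(𝓙')`
  have hJJ' : Ideal.span {a' ^ ν} * J' ≤ Ideal.span {a' ^ (ν - 1)} * derivIdeal k J' := by
    refine Ideal.mul_mono ?_ (le_derivIdeal k J')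
    rw [Ideal.span_singleton_le_span_singleton]
    exact pow_dvd_pow a' (Nat.sub_le ν 1)
  rw [derivIdeal, Ideal.map_sup, sup_le_iff, Ideal.map_span]
  refine ⟨h.trans hJJ', Ideal.span_le.mpr ?_⟩
  rintro _ ⟨_, ⟨δ, f, hf, rfl⟩, rfl⟩
  -- `f · 1 = a'^ν g` with `g ∈ 𝓙'`
  have hf' : algebraMap R S f ∈ Ideal.span {a' ^ ν} * J' := h (Ideal.mem_map_of_mem _ hf)
  obtain ⟨g, hg, hfg⟩ := Ideal.mem_span_singleton_mul.mp hf'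
  obtain ⟨D, hD⟩ := hext δ
  have hDa : D a' = a' * algebraMap R S (δ a) := by rw [ha', hD]
  have key : a' * algebraMap R S (δ f) =
      a' * (a' ^ (ν - 1) * (D g + (ν : S) * algebraMap R S (δ a) * g)) := by
    calc a' * algebraMap R S (δ f) = D (algebraMap R S f) := (hD f).symm
      _ = D (a' ^ ν * g) := by rw [hfg]
      _ = a' ^ ν * D g + g * ((ν : S) * a' ^ (ν - 1) * D a') := by
          rw [Derivation.leibniz, Derivation.leibniz_pow, smul_eq_mul, smul_eq_mul, nsmul_eq_mul,
            smul_eq_mul]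
          ring
      _ = a' * (a' ^ (ν - 1) * (D g + (ν : S) * algebraMap R S (δ a) * g)) := by
          rw [hDa]
          conv_lhs => rw [show a' ^ ν = a' * a' ^ (ν - 1) by
            rw [← pow_succ', Nat.sub_add_cancel hν]]
          ring
  rw [SetLike.mem_coe, (mul_cancel_left_mem_nonZeroDivisors ha).mp key]
  refine Ideal.mul_mem_mul (Ideal.mem_span_singleton_self _) (add_mem (apply_mem_derivIdeal k D hg) ?_)
  exact le_derivIdeal k J' (J'.mul_mem_left _ hg)

/-- **Iterating**: under the same hypotheses, `𝓙·S ⊆ a^μ · 𝓙' ⇒ 𝒟ʳ(𝓙)·S ⊆ a^{μ-r} · 𝒟ʳ(𝓙')`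
for every `r ≤ μ`. [cite: BierstoneGrigorievMilmanWlodarczyk2011, Lemma 3.5.3] -/
theorem map_derivIdealIter_le_pow_mul_derivIdealIter (ha : algebraMap R S a ∈ S⁰)
    (hext : ∀ δ : Derivation k R R, ∃ D : Derivation k S S,
      ∀ r : R, D (algebraMap R S r) = algebraMap R S a * algebraMap R S (δ r))
    {J : Ideal R} {J' : Ideal S} {μ : ℕ}
    (h : J.map (algebraMap R S) ≤ Ideal.span {algebraMap R S a ^ μ} * J') {r : ℕ} (hr : r ≤ μ) :
    (derivIdealIter k r J).map (algebraMap R S) ≤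
      Ideal.span {algebraMap R S a ^ (μ - r)} * derivIdealIter k r J' := by
  induction r with
  | zero => simpa using h
  | succ r ih =>
    have ih' := ih (Nat.le_of_succ_le hr)
    rw [derivIdealIter_succ, derivIdealIter_succ, show μ - (r + 1) = μ - r - 1 by omega]
    exact map_derivIdeal_le_pow_mul_derivIdeal ha hext (by omega) ih'

/-- **BGMW Lemma 3.5.3 on a chart of the blow-up, for all `r ≤ μ`** ("`σᶜ(𝒟ʳ(𝓘, μ)) ⊆
𝒟ʳ(σᶜ(𝓘, μ))`"): if `I·S = (a)` with `a·1` a non-zero-divisor, every `a·δ` extends to `S`, and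
`J ⊆ I^μ` (i.e. `𝓘 ⊆ 𝓘_C^μ`, Lemma 3.2.1, for `C ⊆ supp(𝓘, μ)`), then the controlled transform
`(𝒟ʳ(J)·S : a^{μ-r})` of `𝒟ʳ(𝓘, μ) = (𝒟ʳ𝓘, μ - r)` is contained in `𝒟ʳ((J·S : a^μ))`, the `r`-th
derivative ideal of the controlled transform of `(𝓘, μ)` (`r = 1`:
`colon_map_derivIdeal_le_derivIdeal_colon`). Characteristic-free.
[cite: BierstoneGrigorievMilmanWlodarczyk2011, Lemma 3.5.3] -/
theorem colon_map_derivIdealIter_le_derivIdealIter_colon {I J : Ideal R} {μ : ℕ}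
    (ha : algebraMap R S a ∈ S⁰) (hI : I.map (algebraMap R S) = Ideal.span {algebraMap R S a})
    (hext : ∀ δ : Derivation k R R, ∃ D : Derivation k S S,
      ∀ r : R, D (algebraMap R S r) = algebraMap R S a * algebraMap R S (δ r))
    (hJ : J ≤ I ^ μ) {r : ℕ} (hr : r ≤ μ) :
    ((derivIdealIter k r J).map (algebraMap R S)).colon {algebraMap R S a ^ (μ - r)} ≤
      derivIdealIter k r ((J.map (algebraMap R S)).colon {algebraMap R S a ^ μ}) := by
  set J' : Ideal S := (J.map (algebraMap R S)).colon {algebraMap R S a ^ μ}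
  -- `J·S ⊆ a^μ · (J·S : a^μ)`
  have h0 : J.map (algebraMap R S) ≤ Ideal.span {algebraMap R S a ^ μ} * J' := by
    rw [Ideal.map_le_iff_le_comap]
    intro f hf
    obtain ⟨f', hf'J, hff'⟩ := exists_eq_pow_mul_of_le_pow hI hJ hf
    rw [Ideal.mem_comap, show algebraMap R S f = algebraMap R S a ^ μ * f' from hff']
    exact Ideal.mul_mem_mul (Ideal.mem_span_singleton_self _) hf'J
  have h1 := map_derivIdealIter_le_pow_mul_derivIdealIter ha hext h0 hr
  rw [← colon_span_singleton_mul_eq (pow_mem ha (μ - r)) (derivIdealIter k r J')]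
  intro s hs
  rw [Submodule.mem_colon_singleton] at hs ⊢
  exact h1 hs

/-- **BGMW Lemma 3.6.2 on a chart** (Villamayor: "Let `(𝓘, μ)` be a marked ideal of maximal order
and let `C ⊂ supp(𝓘, μ)` be a smooth center. … Then `σᶜ(𝓘, μ)` is of maximal order." Proof:
"`𝒟^μ(σᶜ(𝓘, μ)) ⊃ σᶜ(𝒟^μ(𝓘), 0) = 𝒪_X`", Lemma 3.5.3 with `r = μ`): under the chart hypotheses,
if `𝒟^μ(J) = R` (`IsOfMaxOrder k J μ`, `CoefficientIdeals.lean`) and `J ⊆ I^μ`, then the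
controlled transform `(J·S : a^μ)` is of maximal order: `𝒟^μ((J·S : a^μ)) = S`. Characteristic-free.
[cite: BierstoneGrigorievMilmanWlodarczyk2011, Lemma 3.6.2] -/
theorem IsOfMaxOrder.colon_map {I J : Ideal R} {μ : ℕ} (h : IsOfMaxOrder k J μ)
    (ha : algebraMap R S a ∈ S⁰) (hI : I.map (algebraMap R S) = Ideal.span {algebraMap R S a})
    (hext : ∀ δ : Derivation k R R, ∃ D : Derivation k S S,
      ∀ r : R, D (algebraMap R S r) = algebraMap R S a * algebraMap R S (δ r))
    (hJ : J ≤ I ^ μ) :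
    IsOfMaxOrder k ((J.map (algebraMap R S)).colon {algebraMap R S a ^ μ}) μ := by
  rw [isOfMaxOrder_iff] at h ⊢
  rw [← top_le_iff]
  have h1 := colon_map_derivIdealIter_le_derivIdealIter_colon ha hI hext hJ (le_refl μ)
  rw [h, Ideal.map_top, Nat.sub_self, pow_zero] at h1
  refine le_trans ?_ h1
  intro s _
  rw [Submodule.mem_colon_singleton]
  exact Submodule.mem_top

end Chart

section ChartExplicit

variable (k : Type u) [CommRing k] {R : Type v} {S : Type w} [CommRing R] [CommRing S]
  [Algebra k R] [Algebra k S] [Algebra R S] {a : R}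

/-- `colon_map_derivIdealIter_le_derivIdealIter_colon` with the base ring `k` explicit (argument
convention of `colon_map_derivIdeal_le_derivIdeal_colon`): **BGMW Lemma 3.5.3 on a chart, all
`r ≤ μ`**. [cite: BierstoneGrigorievMilmanWlodarczyk2011, Lemma 3.5.3] -/
theorem colon_map_derivIdealIter_le {I J : Ideal R} {μ : ℕ} (ha : algebraMap R S a ∈ S⁰)
    (hI : I.map (algebraMap R S) = Ideal.span {algebraMap R S a})
    (hext : ∀ δ : Derivation k R R, ∃ D : Derivation k S S,
      ∀ r : R, D (algebraMap R S r) = algebraMap R S a * algebraMap R S (δ r))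
    (hJ : J ≤ I ^ μ) {r : ℕ} (hr : r ≤ μ) :
    ((derivIdealIter k r J).map (algebraMap R S)).colon {algebraMap R S a ^ (μ - r)} ≤
      derivIdealIter k r ((J.map (algebraMap R S)).colon {algebraMap R S a ^ μ}) :=
  colon_map_derivIdealIter_le_derivIdealIter_colon ha hI hext hJ hr

end ChartExplicit

/-! ## On the affine blowup algebra `R[I/a]` -/

section BlowupAlgebra

variable (k : Type v) [CommRing k] {R : Type u} [CommRing R] [Algebra k R] {I : Ideal R} {a : R}

/-- **BGMW Lemma 3.5.3 on the charts `R[I/a]` of a blow-up, for all `r ≤ μ`**: for `a ∈ I`,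
`J ⊆ I^μ` and `r ≤ μ`, `(𝒟ʳ(J)·R[I/a] : a^{μ-r}) ⊆ 𝒟ʳ((J·R[I/a] : a^μ))` — the hypotheses of the
abstract chart lemma being `algebraMap_mem_nonZeroDivisors_blowupAlgebra`,
`map_blowupAlgebra_eq_span` and `exists_derivation_blowupAlgebra` (`AffineBlowupAlgebra.lean`);
`r = 1` is `blowupAlgebra.colon_map_derivIdeal_le`. Characteristic-free.
[cite: BierstoneGrigorievMilmanWlodarczyk2011, Lemma 3.5.3] -/
theorem blowupAlgebra.colon_map_derivIdealIter_le (ha : a ∈ I) {J : Ideal R} {μ : ℕ}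
    (hJ : J ≤ I ^ μ) {r : ℕ} (hr : r ≤ μ) :
    ((derivIdealIter k r J).map (algebraMap R (blowupAlgebra I a))).colon
        {algebraMap R (blowupAlgebra I a) a ^ (μ - r)} ≤
      derivIdealIter k r ((J.map (algebraMap R (blowupAlgebra I a))).colon
        {algebraMap R (blowupAlgebra I a) a ^ μ}) :=
  colon_map_derivIdealIter_le_derivIdealIter_colon (k := k) (S := blowupAlgebra I a) (a := a)
    (I := I) (J := J) (μ := μ) algebraMap_mem_nonZeroDivisors_blowupAlgebra
    (map_blowupAlgebra_eq_span ha) (exists_derivation_blowupAlgebra k) hJ hr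

/-- `blowupAlgebra.colon_map_derivIdealIter_le` with the base ring `k` as for
`blowupAlgebra.colon_map_derivIdeal_le`: **BGMW Lemma 3.5.3 on `R[I/a]`, all `r ≤ μ`**.
[cite: BierstoneGrigorievMilmanWlodarczyk2011, Lemma 3.5.3] -/
theorem colon_map_derivIdealIter_le_blowupAlgebra (ha : a ∈ I) {J : Ideal R} {μ : ℕ}
    (hJ : J ≤ I ^ μ) {r : ℕ} (hr : r ≤ μ) :
    ((derivIdealIter k r J).map (algebraMap R (blowupAlgebra I a))).colon
        {algebraMap R (blowupAlgebra I a) a ^ (μ - r)} ≤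
      derivIdealIter k r ((J.map (algebraMap R (blowupAlgebra I a))).colon
        {algebraMap R (blowupAlgebra I a) a ^ μ}) :=
  blowupAlgebra.colon_map_derivIdealIter_le k ha hJ hr

/-- **BGMW Lemma 3.6.2 on the charts `R[I/a]` of a blow-up**: for `a ∈ I`, `J ⊆ I^μ` and `J` of
maximal order `μ` (`𝒟^μ(J) = R`), the controlled transform `(J·R[I/a] : a^μ)` is of maximal order
`μ`. Characteristic-free. [cite: BierstoneGrigorievMilmanWlodarczyk2011, Lemma 3.6.2] -/
theorem IsOfMaxOrder.colon_map_blowupAlgebra (ha : a ∈ I) {J : Ideal R} {μ : ℕ}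
    (h : IsOfMaxOrder k J μ) (hJ : J ≤ I ^ μ) :
    IsOfMaxOrder k ((J.map (algebraMap R (blowupAlgebra I a))).colon
      {algebraMap R (blowupAlgebra I a) a ^ μ}) μ :=
  IsOfMaxOrder.colon_map (S := blowupAlgebra I a) (a := a) (I := I) (J := J) (μ := μ) h
    algebraMap_mem_nonZeroDivisors_blowupAlgebra (map_blowupAlgebra_eq_span ha)
    (exists_derivation_blowupAlgebra k) hJ

end BlowupAlgebra

end Literature.AlgebraicGeometry.Resolution
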